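import Summits.ResolutionOfSingularities.ResolutionOfSingularities.Theorems.FrobeniusLadderFRationalResolutionFixedPointFibre
import Mathlib.RingTheory.Finiteness.Ideal
import Mathlib.RingTheory.Localization.AtPrime.Basic
import HarnessLib

/-!
# Crux `FrobeniusLadder.FRationalResolution` (stmt-ResolutionOfSingularities-15317), line `redirect`,
# stub `stub_diagonalizableQuotientResolution` — a fixed point is cut out, up to nilpotents, by invariants

`S` graded by a TORSION abelian group `A` (`GradedAlgebra 𝒮`, `S₀ = 𝒮 0`, quotient map
`q : Spec S → Spec S₀ = (Spec S)/D(A)`), `𝔔` a `D(A)`-FIXED prime (containing every `S_a`, `a ≠ 0`),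
`𝔔₀ = 𝔔 ∩ S₀`. Sequel to `…FixedPointFibre.lean` (one-point fibre, residue surjectivity), supplying the input
of `…PrimaryDescent.lean` (`𝔪ᵏ ⊆ 𝔫 ⊆ 𝔪B`) and of the completion comparison in the local linearisation step
(L3): **the `𝔔`-adic and the `𝔔₀S`-adic topologies agree.**

* `le_radical_map_comap_of_fixed`, `radical_map_comap_of_fixed` — `𝔔 = √(𝔔₀ S)`: a homogeneous `s ∈ 𝔔 ∩ S_a`
  has `s^{ord a} ∈ 𝔔 ∩ S₀ = 𝔔₀`, and every element of `𝔔` is a sum of such (its degree-`0` component lies in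
  `𝔔` too, `mem_iff_decompose_zero_mem`);
* `exists_pow_le_map_comap_of_fixed` — for Noetherian `S`, `𝔔ᴺ ⊆ 𝔔₀ S` for some `N` (scheme-theoretically:
  the fibre `q⁻¹(𝔔₀)`, which is set-theoretically the point `𝔔`, is an infinitesimal thickening of it of
  bounded order);
* `exists_maximalIdeal_pow_le_of_fixed` — in the local ring `S_𝔔`: `𝔪_{S_𝔔}ᴺ ⊆ 𝔔₀ S_𝔔`, so `S_𝔔` is
  `𝔔₀`-adically the same as `𝔪`-adically (and, `S_𝔔` being finite over `(S₀)_{𝔔₀}` by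
  `…FixedPointLocalization.lean`, `Ŝ_𝔔 = S_𝔔 ⊗ (S₀)^_{𝔔₀}`).

Honest label: structure lemmas toward L3 (no stub closed). No definitions, no named facts, no sorry.
[folklore; cite: SGA3, Exp. VIII §§4–5]
-/

noncomputable section

-- single-problem summit: the doubled namespace component is forced
set_option linter.dupNamespace false

open DirectSum

namespace Summit.ResolutionOfSingularities.ResolutionOfSingularities.Theorems.FRationalResolution.FixedPointRadical

open Literature.AlgebraicGeometry.Resolution.DiagonalizableQuotient (pow_addOrderOf_mem_gradeZero)
open FixedPointFibre (mem_iff_decompose_zero_mem)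

universe u v w v'

variable {R : Type u} {S : Type v} {A : Type w} [CommRing R] [CommRing S] [Algebra R S]
  [DecidableEq A] [AddCommGroup A] (𝒮 : A → Submodule R S) [GradedAlgebra 𝒮]

/-- **A fixed prime lies in the radical of the extension of its invariant part**: for a torsion grading and
a prime `𝔔 ⊇ S_a` (`a ≠ 0`), `𝔔 ⊆ √(𝔔₀ S)` with `𝔔₀ = 𝔔 ∩ S₀` — each homogeneous component `s_a` of `s ∈ 𝔔`
lies in `𝔔` and `s_a^{ord a} ∈ 𝔔 ∩ S₀ = 𝔔₀`. [folklore; cite: SGA3, Exp. VIII §5] -/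
theorem le_radical_map_comap_of_fixed (hA : AddMonoid.IsTorsion A) (𝔔 : Ideal S) [𝔔.IsPrime]
    (hfix : ∀ a : A, a ≠ 0 → ∀ s ∈ 𝒮 a, s ∈ 𝔔) :
    𝔔 ≤ ((𝔔.comap (algebraMap (𝒮 0) S)).map (algebraMap (𝒮 0) S)).radical := by
  classical
  set I := (𝔔.comap (algebraMap (𝒮 0) S)).map (algebraMap (𝒮 0) S) with hI
  -- a homogeneous element of `𝔔` has a power in `𝔔₀ S`
  have hhom : ∀ (a : A) (t : S), t ∈ 𝒮 a → t ∈ 𝔔 → t ∈ I.radical := by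
    intro a t hta htQ
    have hn : 0 < addOrderOf a := (hA a).addOrderOf_pos
    have hpow0 : t ^ addOrderOf a ∈ 𝒮 0 := pow_addOrderOf_mem_gradeZero 𝒮 hta
    have hpowQ : t ^ addOrderOf a ∈ 𝔔 := Ideal.pow_mem_of_mem 𝔔 htQ _ hn
    refine ⟨addOrderOf a, ?_⟩
    have hmem : (⟨t ^ addOrderOf a, hpow0⟩ : 𝒮 0) ∈ 𝔔.comap (algebraMap (𝒮 0) S) := hpowQ
    exact Ideal.mem_map_of_mem (algebraMap (𝒮 0) S) hmem
  intro s hs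
  rw [← DirectSum.sum_support_decompose 𝒮 s]
  refine Ideal.sum_mem _ fun a _ => hhom a _ (SetLike.coe_mem _) ?_
  by_cases ha : a = 0
  · subst ha
    exact (mem_iff_decompose_zero_mem 𝒮 𝔔 hfix s).mp hs
  · exact hfix a ha _ (SetLike.coe_mem _)

/-- **`𝔔 = √(𝔔₀ S)` at a fixed prime** (torsion grading): the fibre of `Spec S → Spec S₀` over the image of a
fixed point is, as a closed subscheme `V(𝔔₀ S)`, supported exactly at that point. [folklore; cite: SGA3, Exp. VIII §5] -/
theorem radical_map_comap_of_fixed (hA : AddMonoid.IsTorsion A) (𝔔 : Ideal S) [h𝔔 : 𝔔.IsPrime]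
    (hfix : ∀ a : A, a ≠ 0 → ∀ s ∈ 𝒮 a, s ∈ 𝔔) :
    ((𝔔.comap (algebraMap (𝒮 0) S)).map (algebraMap (𝒮 0) S)).radical = 𝔔 :=
  le_antisymm (h𝔔.radical_le_iff.mpr Ideal.map_comap_le) (le_radical_map_comap_of_fixed 𝒮 hA 𝔔 hfix)

/-- **`𝔔ᴺ ⊆ 𝔔₀ S` at a fixed prime of a Noetherian graded ring** (torsion grading): the `𝔔`-adic and
`𝔔₀S`-adic topologies on `S`-modules agree. [folklore; cite: SGA3, Exp. VIII §5] -/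
theorem exists_pow_le_map_comap_of_fixed [IsNoetherianRing S] (hA : AddMonoid.IsTorsion A)
    (𝔔 : Ideal S) [𝔔.IsPrime] (hfix : ∀ a : A, a ≠ 0 → ∀ s ∈ 𝒮 a, s ∈ 𝔔) :
    ∃ N : ℕ, 𝔔 ^ N ≤ (𝔔.comap (algebraMap (𝒮 0) S)).map (algebraMap (𝒮 0) S) :=
  Ideal.exists_pow_le_of_le_radical_of_fg (le_radical_map_comap_of_fixed 𝒮 hA 𝔔 hfix)
    (IsNoetherian.noetherian 𝔔)

/-- **In the local ring at a fixed point, `𝔪ᴺ ⊆ 𝔔₀ S_𝔔`**: for Noetherian `S`, torsion grading and a fixed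
prime `𝔔`, some power of the maximal ideal of any localization `S_𝔔` lies in the extension of `𝔔₀ = 𝔔 ∩ S₀`
— the hypothesis shape `𝔪ᵏ ⊆ 𝔫` of `…PrimaryDescent.lean`, and the reason the `𝔪`-adic completion of `S_𝔔`
is its `𝔔₀`-adic completion. [folklore; cite: SGA3, Exp. VIII §5] -/
theorem exists_maximalIdeal_pow_le_of_fixed [IsNoetherianRing S] (hA : AddMonoid.IsTorsion A)
    (𝔔 : Ideal S) [𝔔.IsPrime] (hfix : ∀ a : A, a ≠ 0 → ∀ s ∈ 𝒮 a, s ∈ 𝔔)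
    (L : Type v') [CommRing L] [Algebra S L] [IsLocalization.AtPrime L 𝔔] [IsLocalRing L] :
    ∃ N : ℕ, IsLocalRing.maximalIdeal L ^ N ≤
      (𝔔.comap (algebraMap (𝒮 0) S)).map ((algebraMap S L).comp (algebraMap (𝒮 0) S)) := by
  obtain ⟨N, hN⟩ := exists_pow_le_map_comap_of_fixed 𝒮 hA 𝔔 hfix
  refine ⟨N, ?_⟩
  rw [← IsLocalization.AtPrime.map_eq_maximalIdeal 𝔔 L, ← Ideal.map_pow, ← Ideal.map_map]
  exact Ideal.map_mono hN

end Summit.ResolutionOfSingularities.ResolutionOfSingularities.Theorems.FRationalResolution.FixedPointRadical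

end
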